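/-
Copyright: the b2b-balaban cell (near-miss cell 7), T⁴-continuum CRUX team (coordinator ruling e34b3e0c item (2)),
seat t4-ne7b-formalise-leaf-06 (gen 28). Released under the licence of the surrounding project.
-/
import Summits.QuantumFields.BalabanUV.T4Continuum.Spine.NE7b.EnergyDichotomy
import Summits.QuantumFields.BalabanUV.T4Continuum.Spine.NE7b.SRWKernelBoundZ4

/-!
# (L1) unconditional: the energy dichotomy for critical unit-quaternion configurations on `ℤ⁴`, heat kernel discharged
# (route NE7b R-H, `t4/ROUTES-NE7b.md` v6.1 Δv6 item 3)

Cell `pub-balaban`, sub-cell `t4`, spine estimate NE7b (node U5c), candidate route R-H ∕ C-RH°. CAPSTONE of this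
lineage's (T-k5)∕(L1) chain, composing BY NAME `EnergyDichotomy.dichotomy` ((L1) modulo the heat-kernel hypothesis
`hC`) with `SRWKernelBoundZ4.kernel_bound` (`hC` with `C = 4`, proved): for a unit-quaternion configuration `U` on `ℤ⁴`
and a finite hole `I` whose plaquettes have all links critical, with `Re P ≥ 0`, `‖E‖ ≤ ½` on `I` and `‖E‖ ≤ b` off `I`:
EITHER `‖E_{ij}(x)‖ ≤ (1+η)·b` on `I` OR `Σ_{x∈I} max_{ij}‖E_{ij}(x)‖² ≥ η⁴∕(4·(1+η)⁴·464²)` — NO hypothesis beyond the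
configuration's (at `η = 1`: `≥ 1∕(64·464²) ≈ 7.3·10⁻⁸`; ROUTES' `ε₁` scale with the kernel's crude `C′_4 = 464` and
`C = 4`; any sharper `C′`, `C` plugs into `EnergyDichotomy.dichotomy` unchanged).

HONEST FRAMING. Law-free kernel facts about ONE configuration; nothing of (JC), (S-E), (MP<L²)'s clauses, nothing of
[Bałaban 1983–89] asserted or cited; `SU(2) ↔` unit quaternions NOT formalised. NE7b (`T4WeightBudget.RelWeightBound`)
NOT PRINTED and NOT PROVED; spine PROVED 0∕9; rung (B)+1 on a FINITE torus T⁴ — NOT infinite volume, NOT the mass gap,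
NOT Clay. HONEST DEPENDENCY: continuum YM on T⁴ ⇐ BetaPertH ∧ nine spine estimates (0/9 proved); BetaPertH ⇐ (D1) ∧ (D4)
∧ CAP+tail; G-an2-4 gates asym, D1 and NE2/3/4. POLICY: crux-route work under `Spine/NE7b/` (ROUTES v6 §10 S-k5);
0 definitions, no `Prop`-valued fact, no `[cite:]` fact.
-/

set_option autoImplicit false

noncomputable section

namespace Summit.QuantumFields.BalabanUV.T4Continuum.NE7b.EnergyDichotomyZ4

open Finset
open scoped BigOperators Quaternion
open Literature.MathematicalPhysics.QuantumFieldTheory (ZdGaugeConfig)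
open Literature.Probability.LatticeModels (Site)
open Summit.QuantumFields.BalabanUV.T4Continuum.NE7b.AbelianCurvatureMaximumPrinciple (e)
open Summit.QuantumFields.BalabanUV.T4Continuum.NE7b.CovariantDivergenceEL (curv covDiv)
open Summit.QuantumFields.BalabanUV.T4Continuum.NE7b.EnergyDichotomy (siteCurv dichotomy dichotomy_sum)
open Summit.QuantumFields.BalabanUV.T4Continuum.NE7b.SRWKernelBoundZ4 (kernel_bound)

/-- **(L1) UNCONDITIONAL.** EITHER the sup bound `‖E_{ij}(x)‖ ≤ (1+η)·b` on the hole, OR the energy quantum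
`Σ_{x∈I} s(x)² ≥ η⁴∕((1+η)⁴·4·464²)`. -/
theorem dichotomy_unconditional (U : ZdGaugeConfig 4 (Metric.sphere (0 : ℍ) 1)) (I : Finset (Site 4)) {b η : ℝ}
    (hb : 0 ≤ b) (hη : 0 < η) (hcrit : ∀ x ∈ I, ∀ i j : Fin 4, i ≠ j → covDiv U x i = 0 ∧ covDiv U (x + e j) i = 0)
    (hre : ∀ (y : Site 4) (a c : Fin 4), 0 ≤ ((ZdGaugeConfig.plaquette U y a c : _) : ℍ).re)
    (hhalf : ∀ x ∈ I, ∀ i j : Fin 4, ‖curv U x i j‖ ≤ 1 / 2) (hout : ∀ y ∉ I, ∀ i j : Fin 4, ‖curv U y i j‖ ≤ b) :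
    (∀ x ∈ I, ∀ i j : Fin 4, ‖curv U x i j‖ ≤ (1 + η) * b)
      ∨ η ^ 4 / ((1 + η) ^ 4 * 4 * 464 ^ 2) ≤ ∑ x ∈ I, siteCurv U x ^ 2 :=
  dichotomy U I kernel_bound hb hη hcrit hre hhalf hout

/-- **(L1) UNCONDITIONAL, energy as a sum over plaquettes.** -/
theorem dichotomy_sum_unconditional (U : ZdGaugeConfig 4 (Metric.sphere (0 : ℍ) 1)) (I : Finset (Site 4)) {b η : ℝ}
    (hb : 0 ≤ b) (hη : 0 < η) (hcrit : ∀ x ∈ I, ∀ i j : Fin 4, i ≠ j → covDiv U x i = 0 ∧ covDiv U (x + e j) i = 0)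
    (hre : ∀ (y : Site 4) (a c : Fin 4), 0 ≤ ((ZdGaugeConfig.plaquette U y a c : _) : ℍ).re)
    (hhalf : ∀ x ∈ I, ∀ i j : Fin 4, ‖curv U x i j‖ ≤ 1 / 2) (hout : ∀ y ∉ I, ∀ i j : Fin 4, ‖curv U y i j‖ ≤ b) :
    (∀ x ∈ I, ∀ i j : Fin 4, ‖curv U x i j‖ ≤ (1 + η) * b)
      ∨ η ^ 4 / ((1 + η) ^ 4 * 4 * 464 ^ 2) ≤ ∑ x ∈ I, ∑ p : Fin 4 × Fin 4, ‖curv U x p.1 p.2‖ ^ 2 :=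
  dichotomy_sum U I kernel_bound hb hη hcrit hre hhalf hout

/-- **(L1) ⇒ ROUTES item 3(a): a hole carrying LESS than the quantum obeys the sup bound** `‖E‖ ≤ (1+η)·b` — the form
consumed by the energy route (E): «if `3B²Λ²ν + slack < ε₁(η)`, (L1) gives `sup_hole ≤ (1+η)·B_coll`», with NO `κ`-clause,
no Hessian, no uniqueness. -/
theorem sup_le_of_energy_lt (U : ZdGaugeConfig 4 (Metric.sphere (0 : ℍ) 1)) (I : Finset (Site 4)) {b η : ℝ}
    (hb : 0 ≤ b) (hη : 0 < η) (hcrit : ∀ x ∈ I, ∀ i j : Fin 4, i ≠ j → covDiv U x i = 0 ∧ covDiv U (x + e j) i = 0)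
    (hre : ∀ (y : Site 4) (a c : Fin 4), 0 ≤ ((ZdGaugeConfig.plaquette U y a c : _) : ℍ).re)
    (hhalf : ∀ x ∈ I, ∀ i j : Fin 4, ‖curv U x i j‖ ≤ 1 / 2) (hout : ∀ y ∉ I, ∀ i j : Fin 4, ‖curv U y i j‖ ≤ b)
    (hE : ∑ x ∈ I, siteCurv U x ^ 2 < η ^ 4 / ((1 + η) ^ 4 * 4 * 464 ^ 2)) :
    ∀ x ∈ I, ∀ i j : Fin 4, ‖curv U x i j‖ ≤ (1 + η) * b :=
  (dichotomy_unconditional U I hb hη hcrit hre hhalf hout).resolve_right (not_le.mpr hE)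

/-- The quantum at `η = 1`: `Σ_{x∈I} s(x)² ≥ 1∕(64·464²)` unless `‖E‖ ≤ 2b` on the hole. -/
theorem dichotomy_one (U : ZdGaugeConfig 4 (Metric.sphere (0 : ℍ) 1)) (I : Finset (Site 4)) {b : ℝ} (hb : 0 ≤ b)
    (hcrit : ∀ x ∈ I, ∀ i j : Fin 4, i ≠ j → covDiv U x i = 0 ∧ covDiv U (x + e j) i = 0)
    (hre : ∀ (y : Site 4) (a c : Fin 4), 0 ≤ ((ZdGaugeConfig.plaquette U y a c : _) : ℍ).re)
    (hhalf : ∀ x ∈ I, ∀ i j : Fin 4, ‖curv U x i j‖ ≤ 1 / 2) (hout : ∀ y ∉ I, ∀ i j : Fin 4, ‖curv U y i j‖ ≤ b) :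
    (∀ x ∈ I, ∀ i j : Fin 4, ‖curv U x i j‖ ≤ 2 * b) ∨ 1 / (64 * 464 ^ 2) ≤ ∑ x ∈ I, siteCurv U x ^ 2 := by
  have h := dichotomy_unconditional U I hb one_pos hcrit hre hhalf hout
  norm_num at h ⊢
  exact h

end Summit.QuantumFields.BalabanUV.T4Continuum.NE7b.EnergyDichotomyZ4
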